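import Mathlib
import HarnessLib
import Summits.ValiantsHypothesis.ValiantsHypothesis.Theorems.LacunarySymmetroidMatrixDescartesOsculationCensusRankTwoSCert

/-!
# ValiantsHypothesis / LacunarySymmetroid — crux `MatrixDescartes` (stmt-ValiantsHypothesis-18050, V1),
# line «osculation-law» (`Cruxes/MatrixDescartes/Lines/osculation_law.lean`), rung O3: the rank-two LOWER certificate at every splitting `(2, s)`
# in the BRANCH currency — windows certified from END-POINT VALUES of `U, V` only (no expansion of `U`, `V`, `N`)

Roster R2664 (b) / R2685 (O3 = val-sym-engine-7; this file engine-7 g6).  Companion of ✓ `…OsculationCensusRankTwoSCert`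
(`osc_rankTwo_finite_card_le` UPPER, `osc_rankTwo_card_ge` LOWER from windows on which `U·V < 0` — which needs the EXPANDED `U, V`,
degree `7α+5n` / `7α+6n`; affordable at `m ≤ 4`, not at the `(2,3)` splittings of C53 or `(2,4)` of C63).

CONTENT.  For a block pencil on `Fin 2 ⊕ Fin s` with `a = det G₂₂`, `m` = the two diagonal cofactors, `δ = det G`
(✓ `OsculationRankTwo.insertionPoly_two`: `Φ = a b² + m b + δ`) the two sheets of the spectral curve over `{a ≠ 0, m² − 4aδ ≥ 0}` are the
continuous BRANCHES `b_ε(t) = (−m(t) + ε·√(m(t)² − 4a(t)δ(t)))/(2a(t))`, `ε = ±1`, and on the curve `a⁴·H = U(t)·b + V(t)`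
(✓ `OsculationCuspGen.hess_reduce_poly`).  Hence along a branch the Hessian is `a⁻⁴·g_ε`, `g_ε(t) = U(t)·b_ε(t) + V(t)`, a continuous function:
* `osc_rankTwo_card_ge_branch` (LOWER, branch form): a list of pairwise `t`-separated windows `(l, u, ε)`, `0 < l ≤ u`, `ε = ±1`, with
  `a ≠ 0`, `m² − 4aδ ≥ 0`, `b_ε > 0` on `[l, u]` and `g_ε(l)·g_ε(u) ≤ 0` exhibits `W.length` distinct osculation points `(t₀, b_ε(t₀))`
  (intermediate value theorem for `g_ε` on `[l, u]`).  The window hypotheses involve only `a, m, δ` on the interval (small closed forms) and the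
  VALUES `U(l), V(l), U(u), V(u)` (✓ `OsculationCuspGen.eval_U` / `eval_V` from nine values of `a, m, δ` and their first two derivatives),
  so an instance never expands `U`, `V` or `N`.
* `osc_rankTwo_two_sided_branch`: UPPER (✓ `osc_rankTwo_finite_card_le`) and LOWER (branch form) in ONE application
  (`Finite ∧ W.length ≤ ncard ∧ ncard ≤ 2·(N_N + N_U)`), so an instance unifies the large hypothesis types once.
* `quadratic_branch_root`: `a·b_ε² + m·b_ε + δ = 0` (the branch lies on the curve). [folklore]
* `pos_add_mul_sqrt_of` / `neg_add_mul_sqrt_of`: the sign of `P + Q·√D` from rational comparisons (`P, Q ≥ 0`-type case splits and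
  `P² ≶ Q²·D`), for certifying the end-point signs of `2a·g_ε = (2aV − mU) + ε·U·√(m² − 4aδ)` in instances. [folklore]

HONEST FRAMING.  Calibration tooling for a line stub (`m ≤ 6` formats are covered by `rungAll`); the LAW `stub_osculationLaw`, the crux
`MatrixDescartes`, Conjecture B and `VP ≠ VNP` are OPEN / NOT proved; no summit statement is proved by this file.  No definitions, no named facts;
Mathlib + the tree files `…OsculationCensusRankTwoSCert` (transitively `…OsculationLawCuspNonMonic`, `…OsculationLawRankTwoColumnDet`, `…FoldLawTwoKCurve`).
-/

-- `Summit.ValiantsHypothesis.ValiantsHypothesis.…` is the tree's mandated single-conjunct layout (Sub = Summit).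
set_option linter.dupNamespace false

noncomputable section

namespace Summit.ValiantsHypothesis.ValiantsHypothesis.Theorems.LacunarySymmetroidMatrixDescartes

open Polynomial Matrix Finset
open scoped BigOperators

namespace OsculationCensus

/-- The branch `b = (−M + ε√(M² − 4AD))/(2A)` (`A ≠ 0`, discriminant `≥ 0`, `ε = ±1`) is a root of `A b² + M b + D`. [folklore] -/
theorem quadratic_branch_root (A M D ε : ℝ) (hA : A ≠ 0) (hdisc : 0 ≤ M ^ 2 - 4 * A * D) (hε : ε = 1 ∨ ε = -1) :
    A * ((-M + ε * Real.sqrt (M ^ 2 - 4 * A * D)) / (2 * A)) ^ 2 + M * ((-M + ε * Real.sqrt (M ^ 2 - 4 * A * D)) / (2 * A)) + D = 0 := by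
  set s := Real.sqrt (M ^ 2 - 4 * A * D) with hsdef
  have hs : s ^ 2 = M ^ 2 - 4 * A * D := Real.sq_sqrt hdisc
  have he : ε ^ 2 = 1 := by rcases hε with rfl | rfl <;> norm_num
  set b := (-M + ε * s) / (2 * A) with hbdef
  have h2 : 2 * A * b = -M + ε * s := by
    rw [hbdef]; field_simp
  have h4 : 4 * A * (A * b ^ 2 + M * b + D) = (2 * A * b) ^ 2 + 2 * M * (2 * A * b) + 4 * A * D := by ring
  rw [h2] at h4
  have h0 : 4 * A * (A * b ^ 2 + M * b + D) = 0 := by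
    rw [h4]; linear_combination s ^ 2 * he + hs
  rcases mul_eq_zero.1 h0 with h | h
  · exact absurd h (mul_ne_zero four_ne_zero hA)
  · exact h

/-- `0 < P + Q·√D` from rational data: `P > 0 ∧ Q ≥ 0`, or `P > 0 ∧ Q²D < P²` (then `|Q√D| < P`), or `Q > 0 ∧ P² < Q²D` (then `Q√D > |P|`);
`D ≥ 0`. [folklore] -/
theorem pos_add_mul_sqrt_of (P Q D : ℝ) (hD : 0 ≤ D)
    (h : (0 < P ∧ 0 ≤ Q) ∨ (0 < P ∧ Q ^ 2 * D < P ^ 2) ∨ (0 < Q ∧ P ^ 2 < Q ^ 2 * D)) :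
    0 < P + Q * Real.sqrt D := by
  have hs0 : 0 ≤ Real.sqrt D := Real.sqrt_nonneg D
  have hs : Real.sqrt D ^ 2 = D := Real.sq_sqrt hD
  rcases h with ⟨hP, hQ⟩ | ⟨hP, hlt⟩ | ⟨hQ, hlt⟩
  · positivity
  · -- |Q √D| < P
    have h1 : (Q * Real.sqrt D) ^ 2 < P ^ 2 := by rw [mul_pow, hs]; exact hlt
    have h2 : |Q * Real.sqrt D| < |P| := sq_lt_sq.1 h1
    rw [abs_of_pos hP] at h2
    have h3 := neg_abs_le (Q * Real.sqrt D)
    linarith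
  · -- Q √D > |P|
    have h1 : P ^ 2 < (Q * Real.sqrt D) ^ 2 := by rw [mul_pow, hs]; exact hlt
    have h2 : |P| < |Q * Real.sqrt D| := sq_lt_sq.1 h1
    rw [abs_of_nonneg (mul_nonneg hQ.le hs0)] at h2
    have h3 := neg_abs_le P
    linarith

/-- `P + Q·√D < 0` from rational data (apply `pos_add_mul_sqrt_of` to `−P, −Q`). [folklore] -/
theorem neg_add_mul_sqrt_of (P Q D : ℝ) (hD : 0 ≤ D)
    (h : (P < 0 ∧ Q ≤ 0) ∨ (P < 0 ∧ Q ^ 2 * D < P ^ 2) ∨ (Q < 0 ∧ P ^ 2 < Q ^ 2 * D)) :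
    P + Q * Real.sqrt D < 0 := by
  have := pos_add_mul_sqrt_of (-P) (-Q) D hD (by
    rcases h with ⟨hP, hQ⟩ | ⟨hP, hlt⟩ | ⟨hQ, hlt⟩
    · exact Or.inl ⟨by linarith, by linarith⟩
    · exact Or.inr (Or.inl ⟨by linarith, by simpa using hlt⟩)
    · exact Or.inr (Or.inr ⟨by linarith, by simpa using hlt⟩))
  linarith

-- the statement carries `U`, `V` (35 products of polynomials) and the osculation set twice.
set_option maxHeartbeats 1600000 in
/-- **Rank-two LOWER certificate in the branch currency, every splitting `(2, s)`.**  With `a, m, δ, U, V` as in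
`osc_rankTwo_finite_card_le`: a list `W` of pairwise `t`-separated windows `(l, u, ε)`, `0 < l ≤ u`, `ε = ±1`, such that on `[l, u]`
`a ≠ 0`, `m² − 4aδ ≥ 0` and the branch `b_ε = (−m + ε√(m² − 4aδ))/(2a)` is positive, and `g_ε = U·b_ε + V` satisfies `g_ε(l)·g_ε(u) ≤ 0`,
exhibits `W.length` distinct osculation points (the line's `osculationSet d S`, unfolded verbatim; assumed finite, e.g. by
`osc_rankTwo_finite_card_le`). [folklore] -/
theorem osc_rankTwo_card_ge_branch {s K : ℕ} (d : Fin K → ℕ) (S : Fin K → Matrix (Fin 2 ⊕ Fin s) (Fin 2 ⊕ Fin s) ℝ)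
    (a m δ Up Vp : ℝ[X])
    (hA : (∑ l, (X : ℝ[X]) ^ d l • ((S l).toBlocks₂₂).map Polynomial.C).det = a)
    (hM : ((∑ l, (X : ℝ[X]) ^ d l • (S l).map Polynomial.C).updateRow (Sum.inl 0) (Pi.single (Sum.inl 0) 1 : Fin 2 ⊕ Fin s → ℝ[X])).det
        + ((∑ l, (X : ℝ[X]) ^ d l • (S l).map Polynomial.C).updateRow (Sum.inl 1) (Pi.single (Sum.inl 1) 1 : Fin 2 ⊕ Fin s → ℝ[X])).det = m)
    (hD : (∑ l, (X : ℝ[X]) ^ d l • (S l).map Polynomial.C).det = δ)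
    (hUp : Up = (4 : ℝ[X]) * a ^ 4 * m * δ * (X * derivative (X * derivative δ)) - (3 : ℝ[X]) * a ^ 4 * m * (X * derivative δ) ^ 2 + (4 : ℝ[X]) * a ^ 4 * δ ^ 2 * (X * derivative (X * derivative m)) - (4 : ℝ[X]) * a ^ 4 * δ * (X * derivative m) * (X * derivative δ) - a ^ 3 * m ^ 3 * (X * derivative (X * derivative δ)) - (5 : ℝ[X]) * a ^ 3 * m ^ 2 * δ * (X * derivative (X * derivative m)) + (4 : ℝ[X]) * a ^ 3 * m ^ 2 * (X * derivative m) * (X * derivative δ) - (8 : ℝ[X]) * a ^ 3 * m * δ ^ 2 * (X * derivative (X * derivative a)) + (2 : ℝ[X]) * a ^ 3 * m * δ * (X * derivative a) * (X * derivative δ) + a ^ 3 * m * δ * (X * derivative m) ^ 2 - (4 : ℝ[X]) * a ^ 3 * δ ^ 2 * (X * derivative a) * (X * derivative m) + a ^ 2 * m ^ 4 * (X * derivative (X * derivative m)) + (6 : ℝ[X]) * a ^ 2 * m ^ 3 * δ * (X * derivative (X * derivative a)) - (2 : ℝ[X]) * a ^ 2 * m ^ 3 * (X * derivative a) * (X *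 derivative δ) - a ^ 2 * m ^ 3 * (X * derivative m) ^ 2 + (4 : ℝ[X]) * a ^ 2 * m ^ 2 * δ * (X * derivative a) * (X * derivative m) + (9 : ℝ[X]) * a ^ 2 * m * δ ^ 2 * (X * derivative a) ^ 2 - a * m ^ 5 * (X * derivative (X * derivative a)) - (7 : ℝ[X]) * a * m ^ 3 * δ * (X * derivative a) ^ 2 + m ^ 5 * (X * derivative a) ^ 2)
    (hVp : Vp = (4 : ℝ[X]) * a ^ 4 * δ ^ 2 * (X * derivative (X * derivative δ)) - (4 : ℝ[X]) * a ^ 4 * δ * (X * derivative δ) ^ 2 - a ^ 3 * m ^ 2 * δ * (X * derivative (X * derivative δ)) - (4 : ℝ[X]) * a ^ 3 * m * δ ^ 2 * (X * derivative (X * derivative m)) + (4 : ℝ[X]) * a ^ 3 * m * δ * (X * derivative m) * (X * derivative δ) - (4 : ℝ[X]) * a ^ 3 * δ ^ 3 * (X * derivative (X * derivative a)) + a ^ 2 * m ^ 3 * δ * (X * derivative (X * derivative m)) + (5 : ℝ[X]) * a ^ 2 * m ^ 2 * δ ^ 2 * (X * derivative (X * derivative a)) - (2 : ℝ[X]) *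 a ^ 2 * m ^ 2 * δ * (X * derivative a) * (X * derivative δ) - a ^ 2 * m ^ 2 * δ * (X * derivative m) ^ 2 + (4 : ℝ[X]) * a ^ 2 * m * δ ^ 2 * (X * derivative a) * (X * derivative m) + (4 : ℝ[X]) * a ^ 2 * δ ^ 3 * (X * derivative a) ^ 2 - a * m ^ 4 * δ * (X * derivative (X * derivative a)) - (6 : ℝ[X]) * a * m ^ 2 * δ ^ 2 * (X * derivative a) ^ 2 + m ^ 4 * δ * (X * derivative a) ^ 2)
    (hfin : {p : Fin 2 → ℝ | 0 < p 0 ∧ 0 < p 1 ∧ MvPolynomial.eval p (∑ l, (MvPolynomial.X (0 : Fin 2) : MvPolynomial (Fin 2) ℝ) ^ d l • (S l).map (MvPolynomial.C : ℝ →+* MvPolynomial (Fin 2) ℝ) +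
      (MvPolynomial.X (1 : Fin 2) : MvPolynomial (Fin 2) ℝ) • (Matrix.fromBlocks 1 0 0 0 : Matrix (Fin 2 ⊕ Fin s) (Fin 2 ⊕ Fin s) ℝ).map (MvPolynomial.C : ℝ →+* MvPolynomial (Fin 2) ℝ)).det = 0 ∧
      MvPolynomial.eval p (MvPolynomial.X 0 * MvPolynomial.pderiv 0 (MvPolynomial.X 0 * MvPolynomial.pderiv 0 (∑ l, (MvPolynomial.X (0 : Fin 2) : MvPolynomial (Fin 2) ℝ) ^ d l • (S l).map
      (MvPolynomial.C : ℝ →+* MvPolynomial (Fin 2) ℝ) + (MvPolynomial.X (1 : Fin 2) : MvPolynomial (Fin 2) ℝ) • (Matrix.fromBlocks 1 0 0 0 : Matrix (Fin 2 ⊕ Fin s) (Fin 2 ⊕ Fin s) ℝ).map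
      (MvPolynomial.C : ℝ →+* MvPolynomial (Fin 2) ℝ)).det) * (MvPolynomial.X 1 * MvPolynomial.pderiv 1 (∑ l, (MvPolynomial.X (0 : Fin 2) : MvPolynomial (Fin 2) ℝ) ^ d l • (S l).map
      (MvPolynomial.C : ℝ →+* MvPolynomial (Fin 2) ℝ) + (MvPolynomial.X (1 : Fin 2) : MvPolynomial (Fin 2) ℝ) • (Matrix.fromBlocks 1 0 0 0 : Matrix (Fin 2 ⊕ Fin s) (Fin 2 ⊕ Fin s) ℝ).map
      (MvPolynomial.C : ℝ →+* MvPolynomial (Fin 2) ℝ)).det) ^ 2 - 2 * (MvPolynomial.X 0 * MvPolynomial.pderiv 0 (MvPolynomial.X 1 * MvPolynomial.pderiv 1 (∑ l, (MvPolynomial.X (0 : Fin 2) :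
      MvPolynomial (Fin 2) ℝ) ^ d l • (S l).map (MvPolynomial.C : ℝ →+* MvPolynomial (Fin 2) ℝ) + (MvPolynomial.X (1 : Fin 2) : MvPolynomial (Fin 2) ℝ) • (Matrix.fromBlocks 1 0 0 0 : Matrix (Fin 2
      ⊕ Fin s) (Fin 2 ⊕ Fin s) ℝ).map (MvPolynomial.C : ℝ →+* MvPolynomial (Fin 2) ℝ)).det)) * (MvPolynomial.X 0 * MvPolynomial.pderiv 0 (∑ l, (MvPolynomial.X (0 : Fin 2) : MvPolynomial (Fin 2) ℝ)
      ^ d l • (S l).map (MvPolynomial.C : ℝ →+* MvPolynomial (Fin 2) ℝ) + (MvPolynomial.X (1 : Fin 2) : MvPolynomial (Fin 2) ℝ) • (Matrix.fromBlocks 1 0 0 0 : Matrix (Fin 2 ⊕ Fin s) (Fin 2 ⊕ Fin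
      s) ℝ).map (MvPolynomial.C : ℝ →+* MvPolynomial (Fin 2) ℝ)).det) * (MvPolynomial.X 1 * MvPolynomial.pderiv 1 (∑ l, (MvPolynomial.X (0 : Fin 2) : MvPolynomial (Fin 2) ℝ) ^ d l • (S l).map
      (MvPolynomial.C : ℝ →+* MvPolynomial (Fin 2) ℝ) + (MvPolynomial.X (1 : Fin 2) : MvPolynomial (Fin 2) ℝ) • (Matrix.fromBlocks 1 0 0 0 : Matrix (Fin 2 ⊕ Fin s) (Fin 2 ⊕ Fin s) ℝ).map
      (MvPolynomial.C : ℝ →+* MvPolynomial (Fin 2) ℝ)).det) + MvPolynomial.X 1 * MvPolynomial.pderiv 1 (MvPolynomial.X 1 * MvPolynomial.pderiv 1 (∑ l, (MvPolynomial.X (0 : Fin 2) : MvPolynomial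
      (Fin 2) ℝ) ^ d l • (S l).map (MvPolynomial.C : ℝ →+* MvPolynomial (Fin 2) ℝ) + (MvPolynomial.X (1 : Fin 2) : MvPolynomial (Fin 2) ℝ) • (Matrix.fromBlocks 1 0 0 0 : Matrix (Fin 2 ⊕ Fin s)
      (Fin 2 ⊕ Fin s) ℝ).map (MvPolynomial.C : ℝ →+* MvPolynomial (Fin 2) ℝ)).det) * (MvPolynomial.X 0 * MvPolynomial.pderiv 0 (∑ l, (MvPolynomial.X (0 : Fin 2) : MvPolynomial (Fin 2) ℝ) ^ d l •
      (S l).map (MvPolynomial.C : ℝ →+* MvPolynomial (Fin 2) ℝ) + (MvPolynomial.X (1 : Fin 2) : MvPolynomial (Fin 2) ℝ) • (Matrix.fromBlocks 1 0 0 0 : Matrix (Fin 2 ⊕ Fin s) (Fin 2 ⊕ Fin s) ℝ).map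
      (MvPolynomial.C : ℝ →+* MvPolynomial (Fin 2) ℝ)).det) ^ 2) = 0}.Finite)
    (W : List (ℝ × ℝ × ℝ)) (hsep : W.Pairwise (fun v w => v.2.1 < w.1))
    (hW : ∀ w ∈ W, 0 < w.1 ∧ w.1 ≤ w.2.1 ∧ (w.2.2 = 1 ∨ w.2.2 = -1) ∧
      (∀ x, w.1 ≤ x → x ≤ w.2.1 → a.eval x ≠ 0 ∧ 0 ≤ m.eval x ^ 2 - 4 * a.eval x * δ.eval x ∧
        0 < ((-m.eval x + w.2.2 * Real.sqrt (m.eval x ^ 2 - 4 * a.eval x * δ.eval x)) / (2 * a.eval x))) ∧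
      (Up.eval w.1 * ((-m.eval w.1 + w.2.2 * Real.sqrt (m.eval w.1 ^ 2 - 4 * a.eval w.1 * δ.eval w.1)) / (2 * a.eval w.1)) + Vp.eval w.1) *
        (Up.eval w.2.1 * ((-m.eval w.2.1 + w.2.2 * Real.sqrt (m.eval w.2.1 ^ 2 - 4 * a.eval w.2.1 * δ.eval w.2.1)) / (2 * a.eval w.2.1)) + Vp.eval w.2.1) ≤ 0) :
    W.length ≤ {p : Fin 2 → ℝ | 0 < p 0 ∧ 0 < p 1 ∧ MvPolynomial.eval p (∑ l, (MvPolynomial.X (0 : Fin 2) : MvPolynomial (Fin 2) ℝ) ^ d l • (S l).map (MvPolynomial.C : ℝ →+* MvPolynomial (Fin 2) ℝ) +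
      (MvPolynomial.X (1 : Fin 2) : MvPolynomial (Fin 2) ℝ) • (Matrix.fromBlocks 1 0 0 0 : Matrix (Fin 2 ⊕ Fin s) (Fin 2 ⊕ Fin s) ℝ).map (MvPolynomial.C : ℝ →+* MvPolynomial (Fin 2) ℝ)).det = 0 ∧
      MvPolynomial.eval p (MvPolynomial.X 0 * MvPolynomial.pderiv 0 (MvPolynomial.X 0 * MvPolynomial.pderiv 0 (∑ l, (MvPolynomial.X (0 : Fin 2) : MvPolynomial (Fin 2) ℝ) ^ d l • (S l).map
      (MvPolynomial.C : ℝ →+* MvPolynomial (Fin 2) ℝ) + (MvPolynomial.X (1 : Fin 2) : MvPolynomial (Fin 2) ℝ) • (Matrix.fromBlocks 1 0 0 0 : Matrix (Fin 2 ⊕ Fin s) (Fin 2 ⊕ Fin s) ℝ).map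
      (MvPolynomial.C : ℝ →+* MvPolynomial (Fin 2) ℝ)).det) * (MvPolynomial.X 1 * MvPolynomial.pderiv 1 (∑ l, (MvPolynomial.X (0 : Fin 2) : MvPolynomial (Fin 2) ℝ) ^ d l • (S l).map
      (MvPolynomial.C : ℝ →+* MvPolynomial (Fin 2) ℝ) + (MvPolynomial.X (1 : Fin 2) : MvPolynomial (Fin 2) ℝ) • (Matrix.fromBlocks 1 0 0 0 : Matrix (Fin 2 ⊕ Fin s) (Fin 2 ⊕ Fin s) ℝ).map
      (MvPolynomial.C : ℝ →+* MvPolynomial (Fin 2) ℝ)).det) ^ 2 - 2 * (MvPolynomial.X 0 * MvPolynomial.pderiv 0 (MvPolynomial.X 1 * MvPolynomial.pderiv 1 (∑ l, (MvPolynomial.X (0 : Fin 2) :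
      MvPolynomial (Fin 2) ℝ) ^ d l • (S l).map (MvPolynomial.C : ℝ →+* MvPolynomial (Fin 2) ℝ) + (MvPolynomial.X (1 : Fin 2) : MvPolynomial (Fin 2) ℝ) • (Matrix.fromBlocks 1 0 0 0 : Matrix (Fin 2
      ⊕ Fin s) (Fin 2 ⊕ Fin s) ℝ).map (MvPolynomial.C : ℝ →+* MvPolynomial (Fin 2) ℝ)).det)) * (MvPolynomial.X 0 * MvPolynomial.pderiv 0 (∑ l, (MvPolynomial.X (0 : Fin 2) : MvPolynomial (Fin 2) ℝ)
      ^ d l • (S l).map (MvPolynomial.C : ℝ →+* MvPolynomial (Fin 2) ℝ) + (MvPolynomial.X (1 : Fin 2) : MvPolynomial (Fin 2) ℝ) • (Matrix.fromBlocks 1 0 0 0 : Matrix (Fin 2 ⊕ Fin s) (Fin 2 ⊕ Fin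
      s) ℝ).map (MvPolynomial.C : ℝ →+* MvPolynomial (Fin 2) ℝ)).det) * (MvPolynomial.X 1 * MvPolynomial.pderiv 1 (∑ l, (MvPolynomial.X (0 : Fin 2) : MvPolynomial (Fin 2) ℝ) ^ d l • (S l).map
      (MvPolynomial.C : ℝ →+* MvPolynomial (Fin 2) ℝ) + (MvPolynomial.X (1 : Fin 2) : MvPolynomial (Fin 2) ℝ) • (Matrix.fromBlocks 1 0 0 0 : Matrix (Fin 2 ⊕ Fin s) (Fin 2 ⊕ Fin s) ℝ).map
      (MvPolynomial.C : ℝ →+* MvPolynomial (Fin 2) ℝ)).det) + MvPolynomial.X 1 * MvPolynomial.pderiv 1 (MvPolynomial.X 1 * MvPolynomial.pderiv 1 (∑ l, (MvPolynomial.X (0 : Fin 2) : MvPolynomial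
      (Fin 2) ℝ) ^ d l • (S l).map (MvPolynomial.C : ℝ →+* MvPolynomial (Fin 2) ℝ) + (MvPolynomial.X (1 : Fin 2) : MvPolynomial (Fin 2) ℝ) • (Matrix.fromBlocks 1 0 0 0 : Matrix (Fin 2 ⊕ Fin s)
      (Fin 2 ⊕ Fin s) ℝ).map (MvPolynomial.C : ℝ →+* MvPolynomial (Fin 2) ℝ)).det) * (MvPolynomial.X 0 * MvPolynomial.pderiv 0 (∑ l, (MvPolynomial.X (0 : Fin 2) : MvPolynomial (Fin 2) ℝ) ^ d l •
      (S l).map (MvPolynomial.C : ℝ →+* MvPolynomial (Fin 2) ℝ) + (MvPolynomial.X (1 : Fin 2) : MvPolynomial (Fin 2) ℝ) • (Matrix.fromBlocks 1 0 0 0 : Matrix (Fin 2 ⊕ Fin s) (Fin 2 ⊕ Fin s) ℝ).map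
      (MvPolynomial.C : ℝ →+* MvPolynomial (Fin 2) ℝ)).det) ^ 2) = 0}.ncard := by

  classical
  have hΦ := OsculationRankTwo.insertionPoly_two d S
  rw [hA, hM, hD] at hΦ
  rw [hΦ] at hfin ⊢
  set Φ : MvPolynomial (Fin 2) ℝ := (MvPolynomial.X 1 * MvPolynomial.X 1 * Polynomial.aeval (MvPolynomial.X 0 : MvPolynomial (Fin 2) ℝ) a
      + MvPolynomial.X 1 * Polynomial.aeval (MvPolynomial.X 0 : MvPolynomial (Fin 2) ℝ) m
      + Polynomial.aeval (MvPolynomial.X 0 : MvPolynomial (Fin 2) ℝ) δ) with hΦdef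
  set osc := {p : Fin 2 → ℝ | 0 < p 0 ∧ 0 < p 1 ∧ MvPolynomial.eval p Φ = 0 ∧
      MvPolynomial.eval p
        (MvPolynomial.X 0 * MvPolynomial.pderiv 0 (MvPolynomial.X 0 * MvPolynomial.pderiv 0 Φ)
            * (MvPolynomial.X 1 * MvPolynomial.pderiv 1 Φ) ^ 2
          - 2 * (MvPolynomial.X 0 * MvPolynomial.pderiv 0 (MvPolynomial.X 1 * MvPolynomial.pderiv 1 Φ))
            * (MvPolynomial.X 0 * MvPolynomial.pderiv 0 Φ) * (MvPolynomial.X 1 * MvPolynomial.pderiv 1 Φ)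
          + MvPolynomial.X 1 * MvPolynomial.pderiv 1 (MvPolynomial.X 1 * MvPolynomial.pderiv 1 Φ)
            * (MvPolynomial.X 0 * MvPolynomial.pderiv 0 Φ) ^ 2) = 0} with hosc
  -- from real numbers to the set (over `{a ≠ 0}`)
  have mem_of : ∀ p : Fin 2 → ℝ, 0 < p 0 → 0 < p 1 → a.eval (p 0) ≠ 0 →
      a.eval (p 0) * p 1 ^ 2 + m.eval (p 0) * p 1 + δ.eval (p 0) = 0 →
      Up.eval (p 0) * p 1 + Vp.eval (p 0) = 0 → p ∈ osc := by
    intro p h0 h1 hap hΨ0 hl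
    refine ⟨h0, h1, ?_, ?_⟩
    · rw [hΦdef, FoldCurve.eval_Psi]; exact hΨ0
    · rw [OsculationCuspGen.eval_logHessian_Psi a m δ Φ hΦdef p _ _ _ _ _ _ _ _ rfl rfl rfl rfl rfl rfl rfl rfl]
      have hred := OsculationCuspGen.hess_reduce_poly a m δ Up Vp (p 0) (p 1) _ _ _ _ _ _ _ _ _
        rfl rfl rfl rfl rfl rfl rfl rfl rfl hUp hVp hΨ0
      rw [hl] at hred
      exact (mul_eq_zero.1 hred).resolve_left (pow_ne_zero 4 hap)
  -- the branch and the Hessian along it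
  let br : ℝ → ℝ → ℝ := fun ε x => (-m.eval x + ε * Real.sqrt (m.eval x ^ 2 - 4 * a.eval x * δ.eval x)) / (2 * a.eval x)
  let g : ℝ → ℝ → ℝ := fun ε x => Up.eval x * br ε x + Vp.eval x
  have hg_cont : ∀ (ε lo hi : ℝ), (∀ x, lo ≤ x → x ≤ hi → a.eval x ≠ 0) → ContinuousOn (g ε) (Set.Icc lo hi) := by
    intro ε lo hi ha
    have hbr : ContinuousOn (br ε) (Set.Icc lo hi) := by
      refine ContinuousOn.div ?_ ?_ ?_
      · exact ((Polynomial.continuous m).neg.add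
          (continuous_const.mul (((Polynomial.continuous m).pow 2).sub
            ((continuous_const.mul (Polynomial.continuous a)).mul (Polynomial.continuous δ))).sqrt)).continuousOn
      · exact (continuous_const.mul (Polynomial.continuous a)).continuousOn
      · intro x hx
        exact mul_ne_zero two_ne_zero (ha x hx.1 hx.2)
    exact ((Polynomial.continuous Up).continuousOn.mul hbr).add (Polynomial.continuous Vp).continuousOn
  -- index the windows
  set k := W.length with hk
  set l : Fin k → ℝ := fun i => (W.get i).1 with hl
  set u : Fin k → ℝ := fun i => (W.get i).2.1 with hu
  set e : Fin k → ℝ := fun i => (W.get i).2.2 with he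
  have hWi : ∀ i : Fin k, 0 < l i ∧ l i ≤ u i ∧ (e i = 1 ∨ e i = -1) ∧
      (∀ x, l i ≤ x → x ≤ u i → a.eval x ≠ 0 ∧ 0 ≤ m.eval x ^ 2 - 4 * a.eval x * δ.eval x ∧ 0 < br (e i) x) ∧
      g (e i) (l i) * g (e i) (u i) ≤ 0 := fun i => by
    simpa [hl, hu, he] using hW (W.get i) (List.get_mem W i)
  have hsep' : ∀ i j : Fin k, i < j → u i < l j := by
    intro i j hij
    have := List.pairwise_iff_get.1 hsep i j hij
    simpa [hl, hu] using this
  -- one zero of `g_ε` per window (intermediate value theorem)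
  have hroot : ∀ i, ∃ t, l i ≤ t ∧ t ≤ u i ∧ g (e i) t = 0 := by
    intro i
    obtain ⟨hl0, hlu, -, hwin, hprod⟩ := hWi i
    have hc : ContinuousOn (g (e i)) (Set.Icc (l i) (u i)) := hg_cont (e i) (l i) (u i) (fun x h1 h2 => (hwin x h1 h2).1)
    rcases mul_nonpos_iff.1 hprod with ⟨h1, h2⟩ | ⟨h1, h2⟩
    · obtain ⟨t, ht, ht0⟩ := intermediate_value_Icc' hlu hc ⟨h2, h1⟩
      exact ⟨t, ht.1, ht.2, ht0⟩
    · obtain ⟨t, ht, ht0⟩ := intermediate_value_Icc hlu hc ⟨h1, h2⟩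
      exact ⟨t, ht.1, ht.2, ht0⟩
  choose t ht using hroot
  -- the exhibited points `(tᵢ, b_ε(tᵢ))`
  set pt : Fin k → (Fin 2 → ℝ) := fun i => ![t i, br (e i) (t i)] with hpt
  have hmem : ∀ i, pt i ∈ osc := by
    intro i
    obtain ⟨htl, htu, hgt⟩ := ht i
    obtain ⟨ha0, hdisc, hb⟩ := (hWi i).2.2.2.1 (t i) htl htu
    have ht0 : 0 < t i := lt_of_lt_of_le (hWi i).1 htl
    have hcurve : a.eval (t i) * (br (e i) (t i)) ^ 2 + m.eval (t i) * (br (e i) (t i)) + δ.eval (t i) = 0 :=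
      quadratic_branch_root _ _ _ _ ha0 hdisc (hWi i).2.2.1
    refine mem_of (pt i) ?_ ?_ ?_ ?_ ?_
    · simpa [hpt] using ht0
    · simpa [hpt] using hb
    · simpa [hpt] using ha0
    · simpa [hpt] using hcurve
    · simpa [hpt] using hgt
  -- distinct abscissae
  have hinj : Function.Injective pt := by
    intro i j hij
    have h0 : t i = t j := by
      have := congr_fun hij 0
      simpa [hpt] using this
    by_contra hne
    rcases lt_or_gt_of_ne hne with h | h
    · have := hsep' i j h
      linarith [(ht i).2.1, (ht j).1]
    · have := hsep' j i h
      linarith [(ht j).2.1, (ht i).1]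
  -- count
  have hsub : ↑(Finset.univ.image pt) ⊆ osc := by
    intro p hp
    rw [Finset.mem_coe, Finset.mem_image] at hp
    obtain ⟨i, -, rfl⟩ := hp
    exact hmem i
  calc k = (Finset.univ.image pt).card := by rw [Finset.card_image_of_injective _ hinj, Finset.card_univ, Fintype.card_fin]
    _ = (↑(Finset.univ.image pt) : Set (Fin 2 → ℝ)).ncard := (Set.ncard_coe_finset _).symm
    _ ≤ osc.ncard := Set.ncard_le_ncard hsub hfin

-- same statement size as `osc_rankTwo_card_ge_branch` plus the upper-side hypotheses.
set_option maxHeartbeats 1600000 in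
/-- **Two-sided rank-two certificate in one application** (UPPER ✓ `osc_rankTwo_finite_card_le` + LOWER `osc_rankTwo_card_ge_branch`):
`Finite ∧ W.length ≤ ncard ∧ ncard ≤ 2·(N_N + N_U)`.  One application per instance keeps the (large) hypothesis types `hM`, `hUp`, `hVp`
unified once. [folklore] -/
theorem osc_rankTwo_two_sided_branch {s K : ℕ} (d : Fin K → ℕ) (S : Fin K → Matrix (Fin 2 ⊕ Fin s) (Fin 2 ⊕ Fin s) ℝ)
    (a m δ Up Vp : ℝ[X])
    (hA : (∑ l, (X : ℝ[X]) ^ d l • ((S l).toBlocks₂₂).map Polynomial.C).det = a)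
    (hM : ((∑ l, (X : ℝ[X]) ^ d l • (S l).map Polynomial.C).updateRow (Sum.inl 0) (Pi.single (Sum.inl 0) 1 : Fin 2 ⊕ Fin s → ℝ[X])).det
        + ((∑ l, (X : ℝ[X]) ^ d l • (S l).map Polynomial.C).updateRow (Sum.inl 1) (Pi.single (Sum.inl 1) 1 : Fin 2 ⊕ Fin s → ℝ[X])).det = m)
    (hD : (∑ l, (X : ℝ[X]) ^ d l • (S l).map Polynomial.C).det = δ)
    (hUp : Up = (4 : ℝ[X]) * a ^ 4 * m * δ * (X * derivative (X * derivative δ)) - (3 : ℝ[X]) * a ^ 4 * m * (X * derivative δ) ^ 2 + (4 : ℝ[X]) * a ^ 4 * δ ^ 2 * (X * derivative (X * derivative m)) - (4 : ℝ[X]) * a ^ 4 * δ * (X * derivative m) * (X * derivative δ) - a ^ 3 * m ^ 3 * (X * derivative (X * derivative δ)) - (5 : ℝ[X]) * a ^ 3 * m ^ 2 * δ * (X * derivative (X * derivative m)) + (4 : ℝ[X]) * a ^ 3 * m ^ 2 * (X * derivative m) * (X * derivative δ) - (8 : ℝ[X]) * a ^ 3 * m * δ ^ 2 * (X * derivative (X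 * derivative a)) + (2 : ℝ[X]) * a ^ 3 * m * δ * (X * derivative a) * (X * derivative δ) + a ^ 3 * m * δ * (X * derivative m) ^ 2 - (4 : ℝ[X]) * a ^ 3 * δ ^ 2 * (X * derivative a) * (X * derivative m) + a ^ 2 * m ^ 4 * (X * derivative (X * derivative m)) + (6 : ℝ[X]) * a ^ 2 * m ^ 3 * δ * (X * derivative (X * derivative a)) - (2 : ℝ[X]) * a ^ 2 * m ^ 3 * (X * derivative a) * (X * derivative δ) - a ^ 2 * m ^ 3 * (X * derivative m) ^ 2 + (4 : ℝ[X]) * a ^ 2 * m ^ 2 * δ * (X * derivative a) * (X * derivative m) + (9 : ℝ[X]) * a ^ 2 * m * δ ^ 2 * (X * derivative a) ^ 2 - a * m ^ 5 * (X * derivative (X * derivative a)) - (7 : ℝ[X]) * a * m ^ 3 * δ * (X * derivative a) ^ 2 + m ^ 5 * (X * derivative a) ^ 2)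
    (hVp : Vp = (4 : ℝ[X]) * a ^ 4 * δ ^ 2 * (X * derivative (X * derivative δ)) - (4 : ℝ[X]) * a ^ 4 * δ * (X * derivative δ) ^ 2 - a ^ 3 * m ^ 2 * δ * (X * derivative (X * derivative δ)) - (4 : ℝ[X]) * a ^ 3 * m * δ ^ 2 * (X * derivative (X * derivative m)) + (4 : ℝ[X]) * a ^ 3 * m * δ * (X * derivative m) * (X * derivative δ) - (4 : ℝ[X]) * a ^ 3 * δ ^ 3 * (X * derivative (X * derivative a)) + a ^ 2 * m ^ 3 * δ * (X * derivative (X * derivative m)) + (5 : ℝ[X]) * a ^ 2 * m ^ 2 * δ ^ 2 * (X * derivative (X * derivative a)) - (2 : ℝ[X]) * a ^ 2 * m ^ 2 * δ * (X * derivative a) * (X * derivative δ) - a ^ 2 * m ^ 2 * δ * (X * derivative m) ^ 2 + (4 : ℝ[X]) * a ^ 2 * m * δ ^ 2 * (X * derivative a) * (X * derivative m) + (4 : ℝ[X]) * a ^ 2 * δ ^ 3 * (X * derivative a) ^ 2 - a * m ^ 4 * δ * (X * derivative (X * derivative a)) - (6 : ℝ[X]) * a * m ^ 2 * δ ^ 2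 * (X * derivative a) ^ 2 + m ^ 4 * δ * (X * derivative a) ^ 2)
    (hN : (a * Vp ^ 2 - m * Up * Vp + δ * Up ^ 2) ≠ 0) (hU0 : Up ≠ 0)
    (hray : ∀ t : ℝ, 0 < t → a.eval t = 0 → m.eval t = 0 → δ.eval t ≠ 0)
    (NN NU : ℕ) (hNN : (a * Vp ^ 2 - m * Up * Vp + δ * Up ^ 2).natDegree ≤ NN) (hNU : Up.natDegree ≤ NU)
    (W : List (ℝ × ℝ × ℝ)) (hsep : W.Pairwise (fun v w => v.2.1 < w.1))
    (hW : ∀ w ∈ W, 0 < w.1 ∧ w.1 ≤ w.2.1 ∧ (w.2.2 = 1 ∨ w.2.2 = -1) ∧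
      (∀ x, w.1 ≤ x → x ≤ w.2.1 → a.eval x ≠ 0 ∧ 0 ≤ m.eval x ^ 2 - 4 * a.eval x * δ.eval x ∧
        0 < ((-m.eval x + w.2.2 * Real.sqrt (m.eval x ^ 2 - 4 * a.eval x * δ.eval x)) / (2 * a.eval x))) ∧
      (Up.eval w.1 * ((-m.eval w.1 + w.2.2 * Real.sqrt (m.eval w.1 ^ 2 - 4 * a.eval w.1 * δ.eval w.1)) / (2 * a.eval w.1)) + Vp.eval w.1) *
        (Up.eval w.2.1 * ((-m.eval w.2.1 + w.2.2 * Real.sqrt (m.eval w.2.1 ^ 2 - 4 * a.eval w.2.1 * δ.eval w.2.1)) / (2 * a.eval w.2.1)) + Vp.eval w.2.1) ≤ 0) :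
    {p : Fin 2 → ℝ | 0 < p 0 ∧ 0 < p 1 ∧ MvPolynomial.eval p (∑ l, (MvPolynomial.X (0 : Fin 2) : MvPolynomial (Fin 2) ℝ) ^ d l • (S l).map (MvPolynomial.C : ℝ →+* MvPolynomial (Fin 2) ℝ) +
      (MvPolynomial.X (1 : Fin 2) : MvPolynomial (Fin 2) ℝ) • (Matrix.fromBlocks 1 0 0 0 : Matrix (Fin 2 ⊕ Fin s) (Fin 2 ⊕ Fin s) ℝ).map (MvPolynomial.C : ℝ →+* MvPolynomial (Fin 2) ℝ)).det = 0 ∧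
      MvPolynomial.eval p (MvPolynomial.X 0 * MvPolynomial.pderiv 0 (MvPolynomial.X 0 * MvPolynomial.pderiv 0 (∑ l, (MvPolynomial.X (0 : Fin 2) : MvPolynomial (Fin 2) ℝ) ^ d l • (S l).map
      (MvPolynomial.C : ℝ →+* MvPolynomial (Fin 2) ℝ) + (MvPolynomial.X (1 : Fin 2) : MvPolynomial (Fin 2) ℝ) • (Matrix.fromBlocks 1 0 0 0 : Matrix (Fin 2 ⊕ Fin s) (Fin 2 ⊕ Fin s) ℝ).map
      (MvPolynomial.C : ℝ →+* MvPolynomial (Fin 2) ℝ)).det) * (MvPolynomial.X 1 * MvPolynomial.pderiv 1 (∑ l, (MvPolynomial.X (0 : Fin 2) : MvPolynomial (Fin 2) ℝ) ^ d l • (S l).map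
      (MvPolynomial.C : ℝ →+* MvPolynomial (Fin 2) ℝ) + (MvPolynomial.X (1 : Fin 2) : MvPolynomial (Fin 2) ℝ) • (Matrix.fromBlocks 1 0 0 0 : Matrix (Fin 2 ⊕ Fin s) (Fin 2 ⊕ Fin s) ℝ).map
      (MvPolynomial.C : ℝ →+* MvPolynomial (Fin 2) ℝ)).det) ^ 2 - 2 * (MvPolynomial.X 0 * MvPolynomial.pderiv 0 (MvPolynomial.X 1 * MvPolynomial.pderiv 1 (∑ l, (MvPolynomial.X (0 : Fin 2) :
      MvPolynomial (Fin 2) ℝ) ^ d l • (S l).map (MvPolynomial.C : ℝ →+* MvPolynomial (Fin 2) ℝ) + (MvPolynomial.X (1 : Fin 2) : MvPolynomial (Fin 2) ℝ) • (Matrix.fromBlocks 1 0 0 0 : Matrix (Fin 2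
      ⊕ Fin s) (Fin 2 ⊕ Fin s) ℝ).map (MvPolynomial.C : ℝ →+* MvPolynomial (Fin 2) ℝ)).det)) * (MvPolynomial.X 0 * MvPolynomial.pderiv 0 (∑ l, (MvPolynomial.X (0 : Fin 2) : MvPolynomial (Fin 2) ℝ)
      ^ d l • (S l).map (MvPolynomial.C : ℝ →+* MvPolynomial (Fin 2) ℝ) + (MvPolynomial.X (1 : Fin 2) : MvPolynomial (Fin 2) ℝ) • (Matrix.fromBlocks 1 0 0 0 : Matrix (Fin 2 ⊕ Fin s) (Fin 2 ⊕ Fin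
      s) ℝ).map (MvPolynomial.C : ℝ →+* MvPolynomial (Fin 2) ℝ)).det) * (MvPolynomial.X 1 * MvPolynomial.pderiv 1 (∑ l, (MvPolynomial.X (0 : Fin 2) : MvPolynomial (Fin 2) ℝ) ^ d l • (S l).map
      (MvPolynomial.C : ℝ →+* MvPolynomial (Fin 2) ℝ) + (MvPolynomial.X (1 : Fin 2) : MvPolynomial (Fin 2) ℝ) • (Matrix.fromBlocks 1 0 0 0 : Matrix (Fin 2 ⊕ Fin s) (Fin 2 ⊕ Fin s) ℝ).map
      (MvPolynomial.C : ℝ →+* MvPolynomial (Fin 2) ℝ)).det) + MvPolynomial.X 1 * MvPolynomial.pderiv 1 (MvPolynomial.X 1 * MvPolynomial.pderiv 1 (∑ l, (MvPolynomial.X (0 : Fin 2) : MvPolynomial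
      (Fin 2) ℝ) ^ d l • (S l).map (MvPolynomial.C : ℝ →+* MvPolynomial (Fin 2) ℝ) + (MvPolynomial.X (1 : Fin 2) : MvPolynomial (Fin 2) ℝ) • (Matrix.fromBlocks 1 0 0 0 : Matrix (Fin 2 ⊕ Fin s)
      (Fin 2 ⊕ Fin s) ℝ).map (MvPolynomial.C : ℝ →+* MvPolynomial (Fin 2) ℝ)).det) * (MvPolynomial.X 0 * MvPolynomial.pderiv 0 (∑ l, (MvPolynomial.X (0 : Fin 2) : MvPolynomial (Fin 2) ℝ) ^ d l •
      (S l).map (MvPolynomial.C : ℝ →+* MvPolynomial (Fin 2) ℝ) + (MvPolynomial.X (1 : Fin 2) : MvPolynomial (Fin 2) ℝ) • (Matrix.fromBlocks 1 0 0 0 : Matrix (Fin 2 ⊕ Fin s) (Fin 2 ⊕ Fin s) ℝ).map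
      (MvPolynomial.C : ℝ →+* MvPolynomial (Fin 2) ℝ)).det) ^ 2) = 0}.Finite ∧
    W.length ≤ {p : Fin 2 → ℝ | 0 < p 0 ∧ 0 < p 1 ∧ MvPolynomial.eval p (∑ l, (MvPolynomial.X (0 : Fin 2) : MvPolynomial (Fin 2) ℝ) ^ d l • (S l).map (MvPolynomial.C : ℝ →+* MvPolynomial (Fin 2) ℝ) +
      (MvPolynomial.X (1 : Fin 2) : MvPolynomial (Fin 2) ℝ) • (Matrix.fromBlocks 1 0 0 0 : Matrix (Fin 2 ⊕ Fin s) (Fin 2 ⊕ Fin s) ℝ).map (MvPolynomial.C : ℝ →+* MvPolynomial (Fin 2) ℝ)).det = 0 ∧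
      MvPolynomial.eval p (MvPolynomial.X 0 * MvPolynomial.pderiv 0 (MvPolynomial.X 0 * MvPolynomial.pderiv 0 (∑ l, (MvPolynomial.X (0 : Fin 2) : MvPolynomial (Fin 2) ℝ) ^ d l • (S l).map
      (MvPolynomial.C : ℝ →+* MvPolynomial (Fin 2) ℝ) + (MvPolynomial.X (1 : Fin 2) : MvPolynomial (Fin 2) ℝ) • (Matrix.fromBlocks 1 0 0 0 : Matrix (Fin 2 ⊕ Fin s) (Fin 2 ⊕ Fin s) ℝ).map
      (MvPolynomial.C : ℝ →+* MvPolynomial (Fin 2) ℝ)).det) * (MvPolynomial.X 1 * MvPolynomial.pderiv 1 (∑ l, (MvPolynomial.X (0 : Fin 2) : MvPolynomial (Fin 2) ℝ) ^ d l • (S l).map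
      (MvPolynomial.C : ℝ →+* MvPolynomial (Fin 2) ℝ) + (MvPolynomial.X (1 : Fin 2) : MvPolynomial (Fin 2) ℝ) • (Matrix.fromBlocks 1 0 0 0 : Matrix (Fin 2 ⊕ Fin s) (Fin 2 ⊕ Fin s) ℝ).map
      (MvPolynomial.C : ℝ →+* MvPolynomial (Fin 2) ℝ)).det) ^ 2 - 2 * (MvPolynomial.X 0 * MvPolynomial.pderiv 0 (MvPolynomial.X 1 * MvPolynomial.pderiv 1 (∑ l, (MvPolynomial.X (0 : Fin 2) :
      MvPolynomial (Fin 2) ℝ) ^ d l • (S l).map (MvPolynomial.C : ℝ →+* MvPolynomial (Fin 2) ℝ) + (MvPolynomial.X (1 : Fin 2) : MvPolynomial (Fin 2) ℝ) • (Matrix.fromBlocks 1 0 0 0 : Matrix (Fin 2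
      ⊕ Fin s) (Fin 2 ⊕ Fin s) ℝ).map (MvPolynomial.C : ℝ →+* MvPolynomial (Fin 2) ℝ)).det)) * (MvPolynomial.X 0 * MvPolynomial.pderiv 0 (∑ l, (MvPolynomial.X (0 : Fin 2) : MvPolynomial (Fin 2) ℝ)
      ^ d l • (S l).map (MvPolynomial.C : ℝ →+* MvPolynomial (Fin 2) ℝ) + (MvPolynomial.X (1 : Fin 2) : MvPolynomial (Fin 2) ℝ) • (Matrix.fromBlocks 1 0 0 0 : Matrix (Fin 2 ⊕ Fin s) (Fin 2 ⊕ Fin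
      s) ℝ).map (MvPolynomial.C : ℝ →+* MvPolynomial (Fin 2) ℝ)).det) * (MvPolynomial.X 1 * MvPolynomial.pderiv 1 (∑ l, (MvPolynomial.X (0 : Fin 2) : MvPolynomial (Fin 2) ℝ) ^ d l • (S l).map
      (MvPolynomial.C : ℝ →+* MvPolynomial (Fin 2) ℝ) + (MvPolynomial.X (1 : Fin 2) : MvPolynomial (Fin 2) ℝ) • (Matrix.fromBlocks 1 0 0 0 : Matrix (Fin 2 ⊕ Fin s) (Fin 2 ⊕ Fin s) ℝ).map
      (MvPolynomial.C : ℝ →+* MvPolynomial (Fin 2) ℝ)).det) + MvPolynomial.X 1 * MvPolynomial.pderiv 1 (MvPolynomial.X 1 * MvPolynomial.pderiv 1 (∑ l, (MvPolynomial.X (0 : Fin 2) : MvPolynomial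
      (Fin 2) ℝ) ^ d l • (S l).map (MvPolynomial.C : ℝ →+* MvPolynomial (Fin 2) ℝ) + (MvPolynomial.X (1 : Fin 2) : MvPolynomial (Fin 2) ℝ) • (Matrix.fromBlocks 1 0 0 0 : Matrix (Fin 2 ⊕ Fin s)
      (Fin 2 ⊕ Fin s) ℝ).map (MvPolynomial.C : ℝ →+* MvPolynomial (Fin 2) ℝ)).det) * (MvPolynomial.X 0 * MvPolynomial.pderiv 0 (∑ l, (MvPolynomial.X (0 : Fin 2) : MvPolynomial (Fin 2) ℝ) ^ d l •
      (S l).map (MvPolynomial.C : ℝ →+* MvPolynomial (Fin 2) ℝ) + (MvPolynomial.X (1 : Fin 2) : MvPolynomial (Fin 2) ℝ) • (Matrix.fromBlocks 1 0 0 0 : Matrix (Fin 2 ⊕ Fin s) (Fin 2 ⊕ Fin s) ℝ).map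
      (MvPolynomial.C : ℝ →+* MvPolynomial (Fin 2) ℝ)).det) ^ 2) = 0}.ncard ∧
    {p : Fin 2 → ℝ | 0 < p 0 ∧ 0 < p 1 ∧ MvPolynomial.eval p (∑ l, (MvPolynomial.X (0 : Fin 2) : MvPolynomial (Fin 2) ℝ) ^ d l • (S l).map (MvPolynomial.C : ℝ →+* MvPolynomial (Fin 2) ℝ) +
      (MvPolynomial.X (1 : Fin 2) : MvPolynomial (Fin 2) ℝ) • (Matrix.fromBlocks 1 0 0 0 : Matrix (Fin 2 ⊕ Fin s) (Fin 2 ⊕ Fin s) ℝ).map (MvPolynomial.C : ℝ →+* MvPolynomial (Fin 2) ℝ)).det = 0 ∧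
      MvPolynomial.eval p (MvPolynomial.X 0 * MvPolynomial.pderiv 0 (MvPolynomial.X 0 * MvPolynomial.pderiv 0 (∑ l, (MvPolynomial.X (0 : Fin 2) : MvPolynomial (Fin 2) ℝ) ^ d l • (S l).map
      (MvPolynomial.C : ℝ →+* MvPolynomial (Fin 2) ℝ) + (MvPolynomial.X (1 : Fin 2) : MvPolynomial (Fin 2) ℝ) • (Matrix.fromBlocks 1 0 0 0 : Matrix (Fin 2 ⊕ Fin s) (Fin 2 ⊕ Fin s) ℝ).map
      (MvPolynomial.C : ℝ →+* MvPolynomial (Fin 2) ℝ)).det) * (MvPolynomial.X 1 * MvPolynomial.pderiv 1 (∑ l, (MvPolynomial.X (0 : Fin 2) : MvPolynomial (Fin 2) ℝ) ^ d l • (S l).map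
      (MvPolynomial.C : ℝ →+* MvPolynomial (Fin 2) ℝ) + (MvPolynomial.X (1 : Fin 2) : MvPolynomial (Fin 2) ℝ) • (Matrix.fromBlocks 1 0 0 0 : Matrix (Fin 2 ⊕ Fin s) (Fin 2 ⊕ Fin s) ℝ).map
      (MvPolynomial.C : ℝ →+* MvPolynomial (Fin 2) ℝ)).det) ^ 2 - 2 * (MvPolynomial.X 0 * MvPolynomial.pderiv 0 (MvPolynomial.X 1 * MvPolynomial.pderiv 1 (∑ l, (MvPolynomial.X (0 : Fin 2) :
      MvPolynomial (Fin 2) ℝ) ^ d l • (S l).map (MvPolynomial.C : ℝ →+* MvPolynomial (Fin 2) ℝ) + (MvPolynomial.X (1 : Fin 2) : MvPolynomial (Fin 2) ℝ) • (Matrix.fromBlocks 1 0 0 0 : Matrix (Fin 2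
      ⊕ Fin s) (Fin 2 ⊕ Fin s) ℝ).map (MvPolynomial.C : ℝ →+* MvPolynomial (Fin 2) ℝ)).det)) * (MvPolynomial.X 0 * MvPolynomial.pderiv 0 (∑ l, (MvPolynomial.X (0 : Fin 2) : MvPolynomial (Fin 2) ℝ)
      ^ d l • (S l).map (MvPolynomial.C : ℝ →+* MvPolynomial (Fin 2) ℝ) + (MvPolynomial.X (1 : Fin 2) : MvPolynomial (Fin 2) ℝ) • (Matrix.fromBlocks 1 0 0 0 : Matrix (Fin 2 ⊕ Fin s) (Fin 2 ⊕ Fin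
      s) ℝ).map (MvPolynomial.C : ℝ →+* MvPolynomial (Fin 2) ℝ)).det) * (MvPolynomial.X 1 * MvPolynomial.pderiv 1 (∑ l, (MvPolynomial.X (0 : Fin 2) : MvPolynomial (Fin 2) ℝ) ^ d l • (S l).map
      (MvPolynomial.C : ℝ →+* MvPolynomial (Fin 2) ℝ) + (MvPolynomial.X (1 : Fin 2) : MvPolynomial (Fin 2) ℝ) • (Matrix.fromBlocks 1 0 0 0 : Matrix (Fin 2 ⊕ Fin s) (Fin 2 ⊕ Fin s) ℝ).map
      (MvPolynomial.C : ℝ →+* MvPolynomial (Fin 2) ℝ)).det) + MvPolynomial.X 1 * MvPolynomial.pderiv 1 (MvPolynomial.X 1 * MvPolynomial.pderiv 1 (∑ l, (MvPolynomial.X (0 : Fin 2) : MvPolynomial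
      (Fin 2) ℝ) ^ d l • (S l).map (MvPolynomial.C : ℝ →+* MvPolynomial (Fin 2) ℝ) + (MvPolynomial.X (1 : Fin 2) : MvPolynomial (Fin 2) ℝ) • (Matrix.fromBlocks 1 0 0 0 : Matrix (Fin 2 ⊕ Fin s)
      (Fin 2 ⊕ Fin s) ℝ).map (MvPolynomial.C : ℝ →+* MvPolynomial (Fin 2) ℝ)).det) * (MvPolynomial.X 0 * MvPolynomial.pderiv 0 (∑ l, (MvPolynomial.X (0 : Fin 2) : MvPolynomial (Fin 2) ℝ) ^ d l •
      (S l).map (MvPolynomial.C : ℝ →+* MvPolynomial (Fin 2) ℝ) + (MvPolynomial.X (1 : Fin 2) : MvPolynomial (Fin 2) ℝ) • (Matrix.fromBlocks 1 0 0 0 : Matrix (Fin 2 ⊕ Fin s) (Fin 2 ⊕ Fin s) ℝ).map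
      (MvPolynomial.C : ℝ →+* MvPolynomial (Fin 2) ℝ)).det) ^ 2) = 0}.ncard ≤ 2 * (NN + NU) := by
  obtain ⟨hfin, hle⟩ := osc_rankTwo_finite_card_le d S a m δ Up Vp hA hM hD hUp hVp hN hU0 hray NN NU hNN hNU
  exact ⟨hfin, osc_rankTwo_card_ge_branch d S a m δ Up Vp hA hM hD hUp hVp hfin W hsep hW, hle⟩

end OsculationCensus

end Summit.ValiantsHypothesis.ValiantsHypothesis.Theorems.LacunarySymmetroidMatrixDescartes
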